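import Mathlib.MeasureTheory.Integral.IntervalIntegral.FundThmCalculus
import Mathlib.Analysis.SpecialFunctions.Complex.Arg
import Mathlib.Analysis.Calculus.ContDiff.Deriv
import Mathlib.Analysis.InnerProductSpace.PiL2
import Mathlib.Analysis.InnerProductSpace.Calculus
import Mathlib.Analysis.Calculus.MeanValue
import Mathlib.Analysis.SpecialFunctions.Trigonometric.Deriv
import HarnessLib

/-!
# Normalising the band end: a smooth angle for a smooth unit vector field along an interval

Topic `Literature/Topology/FourManifolds`; fact seat `provefact-IsStrictHandleSlide.isSurgery`
(Kirby (1989), Ch. I §4; remaining content: the named fact (S)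
`Literature.Topology.FourManifolds.FramedLink.IsStrictHandleSlide.slideModel`). The rotation of
the tube about the push-off circle which makes the slide band radial is by *minus the angle* of
the normal derivative of the band end, a nowhere-vanishing plane vector field along the attaching
arc; this file provides the smooth angle (the lift through `θ ↦ (cos θ, sin θ)`), constructed by
integrating the angular velocity `angv = d₀ d₁′ - d₁ d₀′` of the normalised field `d` and identified
with `d` through the conserved quantities `⟪d, (cos α, sin α)⟫` and `d × (cos α, sin α)`
(elementary; e.g. Hirsch, *Differential Topology* (1976), Ch. 4 §4 uses such lifts freely).
Proved here, no definitions, no named facts: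

* `Literature.Topology.FourManifolds.SlideSweep.exists_smooth_angle` — for `d : ℝ → ℝ²` smooth on
  an open interval `(p, q)` with `‖d y‖ = 1` there, a function `α`, smooth on `(p, q)`, with
  `d y = (cos α y, sin α y)` for all `y ∈ (p, q)`.

## References

* R. C. Kirby, *The Topology of 4-Manifolds*, LNM 1374, Springer (1989), Ch. I §4. [Kirby1989]
* M. W. Hirsch, *Differential Topology*, GTM 33, Springer (1976), Ch. 4 §4. [HirschDT1976]
-/

open scoped Topology ContDiff
open Function Set Metric Real MeasureTheory intervalIntegral

noncomputable section

namespace Literature.Topology.FourManifolds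

namespace SlideSweep

/-- An angle for a single unit vector: `(cos α₀, sin α₀) = (a, b)` when `a² + b² = 1`. [folklore] -/
theorem exists_angle_of_sq_add_sq {a b : ℝ} (h : a ^ 2 + b ^ 2 = 1) :
    ∃ α₀ : ℝ, Real.cos α₀ = a ∧ Real.sin α₀ = b := by
  set z : ℂ := ⟨a, b⟩ with hz
  have hnorm : ‖z‖ = 1 := by
    rw [Complex.norm_eq_sqrt_sq_add_sq]
    simp [hz, h]
  have hz0 : z ≠ 0 := by
    intro h0; rw [h0, norm_zero] at hnorm; exact zero_ne_one hnorm
  refine ⟨Complex.arg z, ?_, ?_⟩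
  · rw [Complex.cos_arg hz0, hnorm, div_one]
  · rw [Complex.sin_arg, hnorm, div_one]

/-- **A smooth angle for a smooth unit vector field along an open interval.** See the module
docstring. [cite: HirschDT1976, Ch. 4 §4] -/
theorem exists_smooth_angle {d : ℝ → EuclideanSpace ℝ (Fin 2)} {p q : ℝ}
    (hd : ContDiffOn ℝ ∞ d (Ioo p q)) (h1 : ∀ y ∈ Ioo p q, ‖d y‖ = 1) :
    ∃ α : ℝ → ℝ, ContDiffOn ℝ ∞ α (Ioo p q) ∧
      ∀ y ∈ Ioo p q, d y 0 = Real.cos (α y) ∧ d y 1 = Real.sin (α y) := by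
  rcases (Ioo p q).eq_empty_or_nonempty with he | ⟨y₀, hy₀⟩
  · exact ⟨fun _ ↦ 0, by rw [he]; exact contDiffOn_empty, by rw [he]; simp⟩
  have hI : IsOpen (Ioo p q) := isOpen_Ioo
  -- the two components and their derivatives
  set d0 : ℝ → ℝ := fun y ↦ d y 0 with hd0
  set d1 : ℝ → ℝ := fun y ↦ d y 1 with hd1
  have hd0s : ContDiffOn ℝ ∞ d0 (Ioo p q) := fun y hy ↦
    ((contDiff_euclidean.1 contDiff_id 0).contDiffAt.comp_contDiffWithinAt y (hd y hy))
  have hd1s : ContDiffOn ℝ ∞ d1 (Ioo p q) := fun y hy ↦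
    ((contDiff_euclidean.1 contDiff_id 1).contDiffAt.comp_contDiffWithinAt y (hd y hy))
  have hd0' : ContDiffOn ℝ ∞ (deriv d0) (Ioo p q) := ((contDiffOn_infty_iff_deriv_of_isOpen hI).1 hd0s).2
  have hd1' : ContDiffOn ℝ ∞ (deriv d1) (Ioo p q) := ((contDiffOn_infty_iff_deriv_of_isOpen hI).1 hd1s).2
  have hd0d : DifferentiableOn ℝ d0 (Ioo p q) := ((contDiffOn_infty_iff_deriv_of_isOpen hI).1 hd0s).1
  have hd1d : DifferentiableOn ℝ d1 (Ioo p q) := ((contDiffOn_infty_iff_deriv_of_isOpen hI).1 hd1s).1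
  have hsq : ∀ y ∈ Ioo p q, d0 y ^ 2 + d1 y ^ 2 = 1 := fun y hy ↦ by
    have h := h1 y hy
    rw [EuclideanSpace.norm_eq, Fin.sum_univ_two, Real.sqrt_eq_one] at h
    simpa [sq_abs] using h
  -- the angular velocity
  set angv : ℝ → ℝ := fun y ↦ d0 y * deriv d1 y - d1 y * deriv d0 y with hav
  have havs : ContDiffOn ℝ ∞ angv (Ioo p q) := (hd0s.mul hd1').sub (hd1s.mul hd0')
  have havc : ContinuousOn angv (Ioo p q) := havs.continuousOn
  -- the initial angle and the angle function
  obtain ⟨α₀, hc0, hs0⟩ := exists_angle_of_sq_add_sq (hsq y₀ hy₀)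
  set α : ℝ → ℝ := fun y ↦ α₀ + ∫ t in y₀..y, angv t with hα
  -- `α' = angv` on the interval
  have hαd : ∀ y ∈ Ioo p q, HasDerivAt α (angv y) y := by
    intro y hy
    have hsub : uIcc y₀ y ⊆ Ioo p q := by
      rcases le_total y₀ y with h | h
      · rw [uIcc_of_le h]; exact Icc_subset_Ioo hy₀.1 hy.2
      · rw [uIcc_of_ge h]; exact Icc_subset_Ioo hy.1 hy₀.2
    have hint : IntervalIntegrable angv volume y₀ y := (havc.mono hsub).intervalIntegrable
    have hmeas : StronglyMeasurableAtFilter angv (𝓝 y) volume :=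
      havc.stronglyMeasurableAtFilter hI y hy
    have hcont : ContinuousAt angv y := havc.continuousAt (hI.mem_nhds hy)
    have h := integral_hasDerivAt_right hint hmeas hcont
    simpa [hα] using h.const_add α₀
  have hαdiff : DifferentiableOn ℝ α (Ioo p q) := fun y hy ↦ (hαd y hy).differentiableAt.differentiableWithinAt
  have hαderiv : (Ioo p q).EqOn (deriv α) angv := fun y hy ↦ (hαd y hy).deriv
  have hαs : ContDiffOn ℝ ∞ α (Ioo p q) :=
    (contDiffOn_infty_iff_deriv_of_isOpen hI).2 ⟨hαdiff, havs.congr hαderiv⟩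
  -- `d' = angv J d` in components: `d0' = -angv d1`, `d1' = angv d0`
  have hrel : ∀ y ∈ Ioo p q, d0 y * deriv d0 y + d1 y * deriv d1 y = 0 := by
    intro y hy
    -- differentiate `d0² + d1² = 1`
    have h0 : HasDerivAt d0 (deriv d0 y) y := (hd0d.differentiableAt (hI.mem_nhds hy)).hasDerivAt
    have h1' : HasDerivAt d1 (deriv d1 y) y := (hd1d.differentiableAt (hI.mem_nhds hy)).hasDerivAt
    have hs : HasDerivAt (fun t ↦ d0 t * d0 t + d1 t * d1 t)
        (deriv d0 y * d0 y + d0 y * deriv d0 y + (deriv d1 y * d1 y + d1 y * deriv d1 y)) y :=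
      (h0.mul h0).add (h1'.mul h1')
    have hconst : HasDerivAt (fun t ↦ d0 t * d0 t + d1 t * d1 t) 0 y := by
      refine (hasDerivAt_const y (1 : ℝ)).congr_of_eventuallyEq ?_
      filter_upwards [hI.mem_nhds hy] with t ht
      have := hsq t ht
      simp only [sq] at this
      exact this
    have := hs.unique hconst
    linarith
  have hd0_eq : ∀ y ∈ Ioo p q, deriv d0 y = -(angv y * d1 y) := by
    intro y hy
    have h := hrel y hy
    have hs := hsq y hy
    simp only [hav]
    linear_combination (d0 y) * h - (deriv d0 y) * hs
  have hd1_eq : ∀ y ∈ Ioo p q, deriv d1 y = angv y * d0 y := by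
    intro y hy
    have h := hrel y hy
    have hs := hsq y hy
    simp only [hav]
    linear_combination (d1 y) * h - (deriv d1 y) * hs
  -- the conserved quantities
  set f : ℝ → ℝ := fun y ↦ d0 y * Real.cos (α y) + d1 y * Real.sin (α y) with hf
  set g : ℝ → ℝ := fun y ↦ d0 y * Real.sin (α y) - d1 y * Real.cos (α y) with hg
  have hfd : ∀ y ∈ Ioo p q, HasDerivAt f 0 y := by
    intro y hy
    have h0 : HasDerivAt d0 (deriv d0 y) y := (hd0d.differentiableAt (hI.mem_nhds hy)).hasDerivAt
    have h1' : HasDerivAt d1 (deriv d1 y) y := (hd1d.differentiableAt (hI.mem_nhds hy)).hasDerivAt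
    have hc : HasDerivAt (fun t ↦ Real.cos (α t)) (-Real.sin (α y) * angv y) y := (hαd y hy).cos
    have hsn : HasDerivAt (fun t ↦ Real.sin (α t)) (Real.cos (α y) * angv y) y := (hαd y hy).sin
    have h := (h0.mul hc).add (h1'.mul hsn)
    have hval : deriv d0 y * Real.cos (α y) + d0 y * (-Real.sin (α y) * angv y) +
        (deriv d1 y * Real.sin (α y) + d1 y * (Real.cos (α y) * angv y)) = 0 := by
      rw [hd0_eq y hy, hd1_eq y hy]; ring
    rw [hval] at h
    exact h
  have hgd : ∀ y ∈ Ioo p q, HasDerivAt g 0 y := by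
    intro y hy
    have h0 : HasDerivAt d0 (deriv d0 y) y := (hd0d.differentiableAt (hI.mem_nhds hy)).hasDerivAt
    have h1' : HasDerivAt d1 (deriv d1 y) y := (hd1d.differentiableAt (hI.mem_nhds hy)).hasDerivAt
    have hc : HasDerivAt (fun t ↦ Real.cos (α t)) (-Real.sin (α y) * angv y) y := (hαd y hy).cos
    have hsn : HasDerivAt (fun t ↦ Real.sin (α t)) (Real.cos (α y) * angv y) y := (hαd y hy).sin
    have h := (h0.mul hsn).sub (h1'.mul hc)
    have hval : deriv d0 y * Real.sin (α y) + d0 y * (Real.cos (α y) * angv y) -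
        (deriv d1 y * Real.cos (α y) + d1 y * (-Real.sin (α y) * angv y)) = 0 := by
      rw [hd0_eq y hy, hd1_eq y hy]; ring
    rw [hval] at h
    exact h
  have hpre : IsPreconnected (Ioo p q) := isPreconnected_Ioo
  have hfconst : ∀ y ∈ Ioo p q, f y = f y₀ := fun y hy ↦
    hI.is_const_of_deriv_eq_zero hpre (fun t ht ↦ (hfd t ht).differentiableAt.differentiableWithinAt)
      (fun t ht ↦ (hfd t ht).deriv) hy hy₀
  have hgconst : ∀ y ∈ Ioo p q, g y = g y₀ := fun y hy ↦
    hI.is_const_of_deriv_eq_zero hpre (fun t ht ↦ (hgd t ht).differentiableAt.differentiableWithinAt)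
      (fun t ht ↦ (hgd t ht).deriv) hy hy₀
  -- initial values: `α y₀ = α₀`, `f y₀ = 1`, `g y₀ = 0`
  have hαy₀ : α y₀ = α₀ := by simp [hα]
  have hfy₀ : f y₀ = 1 := by
    simp only [hf, hαy₀, hc0, hs0]
    have := hsq y₀ hy₀; nlinarith
  have hgy₀ : g y₀ = 0 := by
    simp only [hg, hαy₀, hc0, hs0]; ring
  refine ⟨α, hαs, fun y hy ↦ ?_⟩
  have hfy : d0 y * Real.cos (α y) + d1 y * Real.sin (α y) = 1 := by
    have := hfconst y hy; rw [hfy₀] at this; exact this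
  have hgy : d0 y * Real.sin (α y) - d1 y * Real.cos (α y) = 0 := by
    have := hgconst y hy; rw [hgy₀] at this; exact this
  have hs := hsq y hy
  have hcs := Real.cos_sq_add_sin_sq (α y)
  -- solve the linear system
  constructor
  · show d0 y = Real.cos (α y)
    linear_combination Real.cos (α y) * hfy + Real.sin (α y) * hgy - d0 y * hcs
  · show d1 y = Real.sin (α y)
    linear_combination Real.sin (α y) * hfy - Real.cos (α y) * hgy - d1 y * hcs

end SlideSweep

end Literature.Topology.FourManifolds
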